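import Summits.BirchSwinnertonDyer.BirchSwinnertonDyer.Theorems.Rank1ResidualJetLocalTransverse
import Summits.BirchSwinnertonDyer.Rank1Residual.X11b.RingClassFieldConj
import Literature.NumberTheory.EllipticCurves.TransverseConditionGaloisTransport
import HarnessLib

/-!
# T1 JET (cell `bsd-jet`), road K: the local print-to-type input `h𝒯σ` PROVED — the local action
# `σ_* = conjActPlace` carries Jetchev's intrinsic transverse family at `v` into the one at `σ v`

HONEST FRAMING (programme file §HONESTY, verbatim): «no tranche here proves BSD; ARM L moves the
LITERAL column of an r ≤ 1 census into the kernel-proved-modulo-named-print column.» THEOREMS ONLY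
(seat `bsd-jet-lit-ty`, session g7; node `Rank1Residual/JET`, the typer's lane — `Summits/…/Theorems` is
prover-only); 0 classes move; plumbing (transport of structure), nothing `p`-specific, no named fact.

WHAT THIS IS. The H63 line `JET.tamagawaExponent_le_mInfty_of_localFacts'`
(`Theorems/Rank1ResidualJetThm63LocalFactsPrime.lean`, p515562, lines 106–120) carries the binder
`h𝒯σ` «LOCAL PRINT-TO-TYPE: the intrinsic transverse condition is `τ`-stable (Gross §3 dihedral)»: for
every Selmer structure `𝒯` on `E[n]/K` whose finite part is Jetchev's transverse family in the tree's
intrinsic rendering (`exists_localTransverseFamily`, p509971),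
`𝒯_v = ⨅_{ℓ ∣ c, ℓ ∈ v} ⨅_{w' ∣ v} ker (H¹(K_v, E[n]) → H¹(K[ℓ]_{w'}, E[n]))`, and every `τ • v = w`,
`σ_* = conjActPlace W τ n h` maps `𝒯_v` into `𝒯_w`.  Reader 1's pre-audit (HOME
`sheets/D-AUDIT-JET-read-1.addendum-9.md`, 65f2945e023bc101, item (3)) found NO printed sentence for
it — Jetchev 2008 §3.2 (1)–(3) simply let `τ ∈ Gal(K_λ/ℚ_ℓ)` act on `H¹(K_λ, E[p^m])` and on
`H¹_tr(K_λ, E[p^m])` («anti-equivariant (since `K[ℓ]/ℚ` is dihedral)»), which presupposes that the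
transverse condition is `τ`-stable — so it is PROVED here rather than typed as a fact:

* the Literature theorem `conjActPlace_mem_iInf_transverseSubgroup_adicCompletion`
  (`Literature/NumberTheory/EllipticCurves/TransverseConditionGaloisTransport.lean`): for a finite
  Galois `E/K` which is NORMAL OVER `ℚ`, `σ_*` carries `⨅_{w' ∣ v} ker (H¹(K_v, E[n]) → H¹(E_{w'}, E[n]))`
  into `⨅_{w'' ∣ σv} ker (H¹(K_{σv}, E[n]) → H¹(E_{w''}, E[n]))` (cocycle bookkeeping
  `[ψ] ↦ [g ↦ τ̃ ψ(Θ⁻¹ g Θ)]`; the image of `Γ_{E_{w'}} → Γ_{K_v}` is `{d : d|_{K̄}` fixes `ιE(E)}` for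
  EVERY `w' ∣ v`, `SemiLocal.mem_range_absGaloisRestrict_adicCompletion_iff`; and `τ̃ (ιE E) = ιE E`);
* applied to `E = K[ℓ] = ringClassField K ι ℓ`, which IS Galois over `K`
  (`finiteDimensional_and_isGalois_ringClassField`) and Galois over `ℚ` — x11b3's
  `X11b.RingClassConj.isGalois_rat_ringClassField` (Cox Lemma 9.3 «`L` is a Galois extension of `ℚ`»;
  Gross 1991 §3 «`τ` is complex conjugation, which lifts to an involution of `K_n`»; Jetchev 2008 §2
  Notation «`K[c]` … Galois and dihedral over `ℚ`»);
* and `ℓ ∈ 𝔭_{τ v} ↔ ℓ ∈ 𝔭_v` (`τ` fixes `ℓ ∈ ℕ`), so the index sets `{ℓ ∣ c : ℓ ∈ v}` at `v` and `τ v`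
  agree.

`conjActPlace_mem_of_eq_iInf_transverseSubgroup` is the clean statement (any `σ ∈ Aut(K/ℚ)`, any
level `n`, any `c`); `forall_conjActPlace_mem_of_eq_iInf_transverseSubgroup` is the binder `h𝒯σ`
VERBATIM (its hypothesis `v ∈ placesDividing K c` is not needed and is ignored), so that the successor
of `bsd-jet-pv-2` plugs
`h𝒯σ := forall_conjActPlace_mem_of_eq_iInf_transverseSubgroup W hK ι τ ((p ^ k : ℕ) : ℤ) c.1`.
References: [cite: Jetchev2008, §2 (Notation), §3.1.2 (p. 814), §3.2 (1)–(3) (p. 815)]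
[cite: GrossLMS1991, §3, §4 (proof of Lemma 4.3)] [cite: Cox2013, §9.A Lemma 9.3]
[cite: CasselsFrohlichANT1967, Ch. VII §1.1] [cite: MazurRubin2004, Def. 1.1.6].
-/

set_option autoImplicit false

noncomputable section

open scoped Classical

open IsDedekindDomain NumberField Field WeierstrassCurve
  Literature.NumberTheory.GaloisRepresentations
  Literature.NumberTheory.GaloisRepresentations.DiscreteGaloisModule
  Literature.NumberTheory.Automorphic Literature
  Literature.NumberTheory.EllipticCurves Literature.NumberTheory.EllipticCurves.Jetchev2008
  Summit.BirchSwinnertonDyer.Rank1Residual.JET.SelmerVocabulary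

namespace Summit.BirchSwinnertonDyer.Rank1Residual.JET

variable {K : Type} [Field K] [NumberField K]

/-- **`h𝒯σ` PROVED (clean form).** For `W/ℚ`, an imaginary quadratic `K` with an embedding
`ι : K → ℂ`, `σ ∈ Aut(K/ℚ)`, a level `n`, a conductor `c`, and a Selmer structure `𝒯` on `E[n]/K`
whose finite part is Jetchev's intrinsic transverse family
`𝒯_v = ⨅_{ℓ ∣ c, ℓ ∈ v} ⨅_{w' ∣ v} ker (H¹(K_v, E[n]) → H¹(K[ℓ]_{w'}, E[n]))`
(`exists_localTransverseFamily`): for `σ • v = w`, the local action `σ_* = conjActPlace W σ n h` maps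
`𝒯_v` into `𝒯_w`.  By `conjActPlace_mem_iInf_transverseSubgroup_adicCompletion` for each `E = K[ℓ]`
(Galois over `K`, `finiteDimensional_and_isGalois_ringClassField`; Galois over `ℚ`,
`X11b.RingClassConj.isGalois_rat_ringClassField` = Cox Lemma 9.3 / Gross §3 / Jetchev §2), and
`ℓ ∈ 𝔭_{σ v} ↔ ℓ ∈ 𝔭_v`. [cite: Jetchev2008, §2 (Notation), §3.1.2 (p. 814), §3.2 (1)–(3) (p. 815)]
[cite: GrossLMS1991, §3] [cite: Cox2013, §9.A Lemma 9.3] [cite: CasselsFrohlichANT1967, Ch. VII §1.1] -/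
theorem conjActPlace_mem_of_eq_iInf_transverseSubgroup (W : WeierstrassCurve ℚ)
    (hK : IsImaginaryQuadratic K) (ι : K →+* ℂ) [∀ j : ℕ, NumberField (ringClassField K ι j)]
    (σ : K ≃ₐ[ℚ] K) (n : ℤ) (c : ℕ)
    (𝒯 : SelmerStructure ((W.baseChange K).torsionGaloisModule n))
    (h𝒯 : ∀ v : HeightOneSpectrum (𝓞 K), 𝒯 (Sum.inr v) =
      ⨅ ℓ ∈ c.primeFactors.filter (fun ℓ : ℕ ↦ ((ℓ : ℕ) : 𝓞 K) ∈ v.asIdeal),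
        ⨅ (w' : HeightOneSpectrum (𝓞 (ringClassField K ι ℓ))) (_ : w'.asIdeal.LiesOver v.asIdeal),
          letI := (adicCompletionOfLiesOver K (ringClassField K ι ℓ) v w').toAlgebra
          transverseSubgroup (GaloisRep.toLocal v ((W.baseChange K).torsionGaloisModule n))
            (w'.adicCompletion (ringClassField K ι ℓ)))
    (v w : HeightOneSpectrum (𝓞 K)) (h : σ • v = w)
    (x : galoisCohomology (((W.baseChange K).torsionGaloisModule n).toLocal (Sum.inr v : Place K)) 1)
    (hx : x ∈ 𝒯 (Sum.inr v)) : conjActPlace W σ n h x ∈ 𝒯 (Sum.inr w) := by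
  subst h
  rw [h𝒯 v] at hx
  rw [h𝒯 (σ • v)]
  refine AddSubgroup.mem_iInf.mpr fun ℓ ↦ AddSubgroup.mem_iInf.mpr fun hℓ ↦ ?_
  obtain ⟨hℓc, hℓw⟩ := Finset.mem_filter.mp hℓ
  have hℓ0 : ℓ ≠ 0 := (Nat.prime_of_mem_primeFactors hℓc).ne_zero
  -- `σ` fixes `ℓ`, so `ℓ ∈ 𝔭_{σ v} ↔ ℓ ∈ 𝔭_v`
  have hσℓ : σ • ((ℓ : ℕ) : 𝓞 K) = ℓ := by
    rw [← MulSemiringAction.toRingHom_apply, map_natCast]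
  have hℓv : ((ℓ : ℕ) : 𝓞 K) ∈ v.asIdeal :=
    (HeightOneSpectrum.smul_mem_smul_asIdeal_iff σ v _).mp (by rw [hσℓ]; exact hℓw)
  have hxℓ := (AddSubgroup.mem_iInf.mp ((AddSubgroup.mem_iInf.mp hx) ℓ))
    (Finset.mem_filter.mpr ⟨hℓc, hℓv⟩)
  -- `K[ℓ]/K` is Galois and `K[ℓ]/ℚ` is Galois (Cox Lemma 9.3)
  haveI : IsGalois K (ringClassField K ι ℓ) :=
    (finiteDimensional_and_isGalois_ringClassField hK ι hℓ0).2
  haveI : IsGalois ℚ (ringClassField K ι ℓ) := X11b.RingClassConj.isGalois_rat_ringClassField hK ι hℓ0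
  exact conjActPlace_mem_iInf_transverseSubgroup_adicCompletion W σ n (ringClassField K ι ℓ) rfl hxℓ

/-- **The binder `h𝒯σ` of `JET.tamagawaExponent_le_mInfty_of_localFacts'` VERBATIM** (its hypothesis
`v ∈ placesDividing K c` is not used): plug
`h𝒯σ := forall_conjActPlace_mem_of_eq_iInf_transverseSubgroup W hK ι τ ((p ^ k : ℕ) : ℤ) c.1`.
[cite: Jetchev2008, §3.2 (1)–(3) (p. 815)] [cite: GrossLMS1991, §3] [cite: Cox2013, §9.A Lemma 9.3] -/
theorem forall_conjActPlace_mem_of_eq_iInf_transverseSubgroup (W : WeierstrassCurve ℚ)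
    (hK : IsImaginaryQuadratic K) (ι : K →+* ℂ) [∀ j : ℕ, NumberField (ringClassField K ι j)]
    (τ : K ≃ₐ[ℚ] K) (n : ℤ) (c : ℕ) :
    ∀ (𝒯 : SelmerStructure ((W.baseChange K).torsionGaloisModule n)),
      (∀ v : HeightOneSpectrum (𝓞 K), 𝒯 (Sum.inr v) =
        ⨅ ℓ ∈ c.primeFactors.filter (fun ℓ : ℕ ↦ ((ℓ : ℕ) : 𝓞 K) ∈ v.asIdeal),
          ⨅ (w' : HeightOneSpectrum (𝓞 (ringClassField K ι ℓ))) (_ : w'.asIdeal.LiesOver v.asIdeal),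
            letI := (adicCompletionOfLiesOver K (ringClassField K ι ℓ) v w').toAlgebra
            transverseSubgroup (GaloisRep.toLocal v ((W.baseChange K).torsionGaloisModule n))
              (w'.adicCompletion (ringClassField K ι ℓ))) →
      ∀ (v w : HeightOneSpectrum (𝓞 K)) (h : τ • v = w), v ∈ placesDividing K c →
      ∀ x : galoisCohomology (((W.baseChange K).torsionGaloisModule n).toLocal
        (Sum.inr v : Place K)) 1,
      x ∈ 𝒯 (Sum.inr v) → conjActPlace W τ n h x ∈ 𝒯 (Sum.inr w) :=
  fun 𝒯 h𝒯 v w h _ x hx ↦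
    conjActPlace_mem_of_eq_iInf_transverseSubgroup W hK ι τ n c 𝒯 h𝒯 v w h x hx

end Summit.BirchSwinnertonDyer.Rank1Residual.JET

end
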